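import Summits.CriticalPhenomena.Ising3DConformalLimit.Theorems.MoebiusLimitExists.Negative.RatioRegularCorollaries
import Literature.Probability.LatticeModels.PointwiseScalingLimitEtaExists
import Summits.CriticalPhenomena.Ising3DConformalLimit.Theorems.MoebiusLimitExists.Negative.PinnedClusterPoints
import Literature.Barriers.CriticalPhenomena.LongRangeTrivialityOnZ3MarginalAudit
import HarnessLib

/-!
# Crux `GaussianLimitNotScreened` (stmt-CriticalPhenomena-13886), line `single-layer-linear-regression`:
# layer shell sums for the double-term limit (stub B2 `stub_doubleTermLimit`, helper 1/3)

THEOREM-ONLY helper file (no definitions). Lattice input for the near-diagonal part of the layer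
double sum `Y_n = Σ_{u,v} n⁻⁴ φ(u/n) φ(v/n) ⟨σ_{(0,u)} σ_{(0,v)}⟩_{β_c}` of stub B2: for a pointwise
scaling limit `S` of the critical Ising₃ correlators with non-degenerate two-point function and
scale covariance of dimension `Δ < 1`,

* `doubleTerm_eventually_dyadic_le`: one dyadic step along the axis costs a factor `θ < 4`,
  `⟨σ₀σ_{2^i e₀}⟩ ≤ θ ⟨σ₀σ_{2^{i+1} e₀}⟩` for large `i` (`θ` close to `2^{2Δ} < 4`);
* `doubleTerm_layer_shell_sum`: the layer sums are carried by the top shell,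
  `Σ_{z ∈ ℤ², 0 < ‖z‖_∞ ≤ 2^{J+2}} ⟨σ₀σ_{(0,z)}⟩ ≤ K · 4^J · ⟨σ₀σ_{2^J e₀}⟩` (Messager–Miracle-Solé bounds
  each shell by the axis value, and `4^j ⟨σ₀σ_{2^j e₀}⟩` grows geometrically since `θ < 4`; the 2-D
  analogue of the karamata line's `stub_dyadicShellSums`);
* `doubleTerm_tendsto_sq_mul_axis`: `n² ⟨σ₀σ_{2n e₀}⟩ → ∞`;
* `stub_doubleTermLimit_nearDiagonal` (registered bookkeeping sub-goal): for every `p` and all large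
  `n` a sup-norm threshold `M ≈ 4n/2^p` with
  `Σ_{0 < ‖z‖_∞ ≤ M} ⟨σ₀σ_{(0,z)}⟩ ≤ C (θ/4)^p n² ⟨σ₀σ_{2n e₀}⟩`.

References: A. Messager, S. Miracle-Solé, J. Stat. Phys. 17 (1977); N. H. Bingham, C. M. Goldie,
J. L. Teugels, Regular Variation (1987), §1.5.6.
-/

noncomputable section

namespace Summit.CriticalPhenomena.Ising3DConformalLimit.Cruxes.GaussianLimitNotScreened.SingleLayerLinearRegression

open Filter Topology Finset
open Literature.Probability.LatticeModels

-- adapted from Theorems/PerfectScreeningGaussianLimitNotScreenedDyadicShellSums.lean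

/-- The sup norm of the layer point `(0, z) ∈ ℤ³` is the sup norm of `z ∈ ℤ²`. [folklore] -/
theorem doubleTerm_supNorm_cons (z : Fin 2 → ℤ) :
    Site.supNorm (Fin.cons 0 z : Site 3) = Site.supNorm z := by
  apply le_antisymm
  · rw [Site.supNorm_le_iff]
    intro i
    refine Fin.cases ?_ (fun j => ?_) i
    · simp
    · rw [Fin.cons_succ]; exact Site.natAbs_le_supNorm z j
  · rw [Site.supNorm_le_iff]
    intro j
    have h := Site.natAbs_le_supNorm (Fin.cons 0 z : Site 3) j.succ
    rwa [Fin.cons_succ] at h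

/-- Messager–Miracle-Solé on the layer: `⟨σ₀σ_{(0,z)}⟩ ≤ ⟨σ₀σ_{m e₀}⟩` whenever `3m ≤ ‖z‖_∞`.
[cite: MessagerMiracleSoleJSP1977, Theorem (monotonicity)] -/
theorem doubleTerm_layer_le_axis {z : Fin 2 → ℤ} {m : ℕ} (h : 3 * m ≤ Site.supNorm z) :
    criticalTwoPoint 3 (Fin.cons 0 z) ≤ criticalTwoPoint 3 (Pi.single (0 : Fin 3) (m : ℤ)) :=
  twoPointPlus_le_of_mul_supNorm_le (d := 3) (criticalBeta_nonneg 3)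
    (x := Pi.single (0 : Fin 3) (m : ℤ)) (y := Fin.cons 0 z)
    (by rwa [Literature.Barriers.CriticalPhenomena.LongRangeIsing.supNorm_single_zero_natCast, doubleTerm_supNorm_cons])

/-- **One dyadic step along the axis**: for `Δ < 1` there is `θ < 4` with
`⟨σ₀σ_{2^i e₀}⟩ ≤ θ ⟨σ₀σ_{2^{i+1}e₀}⟩` for all large `i`
(`⟨σ₀σ_{2^i e₀}⟩/⟨σ₀σ_{2^{i+1}e₀}⟩ → 2^{2Δ} < 4` from the limit at `(0,e₀)`, `(0,2e₀)`). [folklore] -/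
theorem doubleTerm_eventually_dyadic_le {ρ : ℝ → ℝ} {S : CorrFamily 3} {Δ : ℝ}
    (hlim : HasPointwiseScalingLimit (criticalCorr 3) ρ S) (hnd : IsNondegenerateTwoPoint S)
    (hsc : IsScaleCovariant Δ S) (hΔ1 : Δ < 1) :
    ∃ θ : ℝ, 0 < θ ∧ θ < 4 ∧ ∀ᶠ i : ℕ in atTop,
      criticalTwoPoint 3 (Pi.single (0 : Fin 3) ((2:ℤ) ^ i)) ≤
        θ * criticalTwoPoint 3 (Pi.single (0 : Fin 3) ((2:ℤ) ^ (i + 1))) := by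
  have hs₂eq := S_two_unitVec_eq hsc
  set s₁ := S 2 ![0, EuclideanSpace.single (0 : Fin 3) ((1 : ℕ) : ℝ)] with hs₁
  set s₂ := S 2 ![0, EuclideanSpace.single (0 : Fin 3) ((2 : ℕ) : ℝ)] with hs₂
  have hs₁pos : 0 < s₁ := hnd _ (zero_unitVec_mem_nonCoincident (by norm_num))
  have hs₂pos : 0 < s₂ := hnd _ (zero_unitVec_mem_nonCoincident (by norm_num))
  set θ₀ : ℝ := s₁ / s₂ with hθ₀def
  have hθ₀ : θ₀ = (2:ℝ) ^ (2 * Δ) := by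
    rw [hθ₀def, eq_comm, eq_div_iff hs₂pos.ne', hs₂eq, ← mul_assoc, ← Real.rpow_add two_pos]
    have : 2 * Δ + -(2:ℝ) * Δ = 0 := by ring
    rw [this, Real.rpow_zero, one_mul]
  have hθ₀M : θ₀ < 4 := by
    rw [hθ₀, show (4:ℝ) = (2:ℝ) ^ (2:ℝ) by norm_num]
    exact Real.rpow_lt_rpow_of_exponent_lt one_lt_two (by linarith)
  have hθ₀pos : 0 < θ₀ := by rw [hθ₀]; positivity
  set θ : ℝ := (θ₀ + 4) / 2 with hθdef
  have hθθ : θ₀ < θ := by rw [hθdef]; linarith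
  refine ⟨θ, by rw [hθdef]; linarith, by rw [hθdef]; linarith, ?_⟩
  have h1 := tendsto_rescaled_dyadic hlim (t := 1) one_ne_zero
  have h2 := tendsto_rescaled_dyadic hlim (t := 2) two_ne_zero
  have hdiv := h1.div h2 hs₂pos.ne'
  have hev := hdiv.eventually_lt_const hθθ
  have hpos := h2.eventually_const_lt hs₂pos
  obtain ⟨N, hN⟩ := eventually_atTop.1 (hev.and hpos)
  refine eventually_atTop.2 ⟨N + 1, fun i hi => ?_⟩
  obtain ⟨k, rfl⟩ : ∃ k, i = k + 1 := ⟨i - 1, by omega⟩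
  obtain ⟨hk1, hk2⟩ := hN k (by omega)
  have e1 : (((1:ℕ):ℤ) * 2 ^ (k + 1)) = (2:ℤ) ^ (k + 1) := by push_cast; ring
  have e2 : (((2:ℕ):ℤ) * 2 ^ (k + 1)) = (2:ℤ) ^ (k + 1 + 1) := by push_cast; ring
  simp only [e1, e2, Pi.div_apply] at hk1 hk2
  set r := ρ ((2:ℝ)⁻¹ ^ (k + 1)) ^ 2 with hr
  set g₁ := criticalTwoPoint 3 (Pi.single (0 : Fin 3) ((2:ℤ) ^ (k + 1))) with hg₁
  set g₂ := criticalTwoPoint 3 (Pi.single (0 : Fin 3) ((2:ℤ) ^ (k + 1 + 1))) with hg₂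
  have hrpos : 0 < r := by
    rcases (sq_nonneg (ρ ((2:ℝ)⁻¹ ^ (k + 1)))).lt_or_eq with h | h
    · exact h
    · exfalso; rw [hr, ← h, zero_mul] at hk2; exact lt_irrefl _ hk2
  rw [div_lt_iff₀ hk2] at hk1
  have h' : r * g₁ < r * (θ * g₂) := by
    calc r * g₁ < θ * (r * g₂) := hk1
      _ = r * (θ * g₂) := by ring
  exact (lt_of_mul_lt_mul_left h' hrpos.le).le

/-- Iterating the dyadic step: `⟨σ₀σ_{2^J e₀}⟩ ≤ θ^m ⟨σ₀σ_{2^{J+m} e₀}⟩` for `J ≥ i₀`. [folklore] -/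
theorem doubleTerm_dyadic_chain {θ : ℝ} (hθ : 0 < θ) {i₀ : ℕ}
    (h : ∀ i, i₀ ≤ i → criticalTwoPoint 3 (Pi.single (0 : Fin 3) ((2:ℤ) ^ i)) ≤
      θ * criticalTwoPoint 3 (Pi.single (0 : Fin 3) ((2:ℤ) ^ (i + 1))))
    (J m : ℕ) (hJ : i₀ ≤ J) :
    criticalTwoPoint 3 (Pi.single (0 : Fin 3) ((2:ℤ) ^ J)) ≤
      θ ^ m * criticalTwoPoint 3 (Pi.single (0 : Fin 3) ((2:ℤ) ^ (J + m))) := by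
  induction m with
  | zero => simp
  | succ m ih =>
    calc criticalTwoPoint 3 (Pi.single (0 : Fin 3) ((2:ℤ) ^ J))
        ≤ θ ^ m * criticalTwoPoint 3 (Pi.single (0 : Fin 3) ((2:ℤ) ^ (J + m))) := ih
      _ ≤ θ ^ m * (θ * criticalTwoPoint 3 (Pi.single (0 : Fin 3) ((2:ℤ) ^ (J + m + 1)))) :=
          mul_le_mul_of_nonneg_left (h (J + m) (by omega)) (pow_nonneg hθ.le m)
      _ = θ ^ (m + 1) * criticalTwoPoint 3 (Pi.single (0 : Fin 3) ((2:ℤ) ^ (J + (m + 1)))) := by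
          rw [show J + (m + 1) = J + m + 1 by omega, pow_succ θ m]; ring


/-- **Layer shell sums** (2-D analogue of the karamata line's `stub_dyadicShellSums`, exponent
`s = 0`): there are `K > 0`, `θ ∈ (0, 4)` and `i₀` with the dyadic step
`⟨σ₀σ_{2^i e₀}⟩ ≤ θ⟨σ₀σ_{2^{i+1} e₀}⟩` for `i ≥ i₀` and
`Σ_{z ∈ ℤ², 0 < ‖z‖_∞ ≤ 2^{J+2}} ⟨σ₀σ_{(0,z)}⟩_{β_c} ≤ K · 4^J · ⟨σ₀σ_{2^J e₀}⟩_{β_c}` for `J ≥ i₀`: each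
shell `2^{j+2} < ‖z‖_∞ ≤ 2^{j+3}` has `≤ 2^10 4^j` points, on it `⟨σ₀σ_{(0,z)}⟩ ≤ ⟨σ₀σ_{2^j e₀}⟩`
(Messager–Miracle-Solé), and `4^j ⟨σ₀σ_{2^j e₀}⟩` grows geometrically (ratio `≥ 4/θ > 1`).
[cite: BinghamGoldieTeugels1987, §1.5.6, Karamata's theorem (direct half)] -/
theorem doubleTerm_layer_shell_sum {ρ : ℝ → ℝ} {S : CorrFamily 3} {Δ : ℝ}
    (hlim : HasPointwiseScalingLimit (criticalCorr 3) ρ S) (hnd : IsNondegenerateTwoPoint S)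
    (hsc : IsScaleCovariant Δ S) (hΔ1 : Δ < 1) :
    ∃ K θ : ℝ, 0 < K ∧ 0 < θ ∧ θ < 4 ∧ ∃ i₀ : ℕ,
      (∀ i, i₀ ≤ i → criticalTwoPoint 3 (Pi.single (0 : Fin 3) ((2:ℤ) ^ i)) ≤
        θ * criticalTwoPoint 3 (Pi.single (0 : Fin 3) ((2:ℤ) ^ (i + 1)))) ∧
      ∀ J, i₀ ≤ J → ∑ z ∈ (box 2 (2 ^ (J + 2))).erase 0, criticalTwoPoint 3 (Fin.cons 0 z) ≤
        K * 4 ^ J * criticalTwoPoint 3 (Pi.single (0 : Fin 3) ((2:ℤ) ^ J)) := by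
  obtain ⟨θ, hθ, hθM, hev⟩ := doubleTerm_eventually_dyadic_le hlim hnd hsc hΔ1
  obtain ⟨i₀, hi₀⟩ := eventually_atTop.1 hev
  obtain ⟨g, hg⟩ : ∃ g : ℕ → ℝ, ∀ J, g J = criticalTwoPoint 3 (Pi.single (0 : Fin 3) ((2:ℤ) ^ J)) :=
    ⟨_, fun _ => rfl⟩
  obtain ⟨Φ, hΦ⟩ : ∃ Φ : ℕ → ℝ, ∀ J,
      Φ J = ∑ z ∈ (box 2 (2 ^ (J + 2))).erase 0, criticalTwoPoint 3 (Fin.cons 0 z) :=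
    ⟨_, fun _ => rfl⟩
  have hgpos : ∀ J, 0 < g J := fun J => by rw [hg]; exact Summit.CriticalPhenomena.Ising3DConformalLimit.PinnedClusterPoints.criticalTwoPoint_pos3 _
  have hgθ : ∀ J, i₀ ≤ J → g J ≤ θ * g (J + 1) := fun J hJ => by
    rw [hg J, hg (J + 1)]; exact hi₀ J hJ
  -- one-step recurrence: the shell `2^{J+2} < ‖z‖_∞ ≤ 2^{J+3}` contributes `≤ 2^10 4^J g_J`
  have hstep : ∀ J, Φ (J + 1) ≤ Φ J + 2 ^ 10 * 4 ^ J * g J := by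
    intro J
    have hsub : (box 2 (2 ^ (J + 2))).erase 0 ⊆ (box 2 (2 ^ (J + 1 + 2))).erase 0 :=
      Finset.erase_subset_erase 0 (box_mono 2 (Nat.pow_le_pow_right (by norm_num) (by omega)))
    have hsplit := Finset.sum_sdiff hsub (f := fun z => criticalTwoPoint 3 (Fin.cons 0 z))
    rw [hΦ (J + 1), hΦ J, ← hsplit, add_comm]
    refine add_le_add le_rfl ?_
    have hterm : ∀ z ∈ (box 2 (2 ^ (J + 1 + 2))).erase 0 \ (box 2 (2 ^ (J + 2))).erase 0,
        criticalTwoPoint 3 (Fin.cons 0 z) ≤ g J := by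
      intro z hz
      rw [Finset.mem_sdiff, Finset.mem_erase, Finset.mem_erase, mem_box_iff_supNorm_le] at hz
      obtain ⟨⟨hz0, -⟩, hz2⟩ := hz
      have hz2' : ¬ Site.supNorm z ≤ 2 ^ (J + 2) := fun h => hz2 ⟨hz0, mem_box_iff_supNorm_le.2 h⟩
      have h3 : 3 * 2 ^ J ≤ Site.supNorm z := by
        have : 2 ^ (J + 2) = 4 * 2 ^ J := by ring
        omega
      have hle := doubleTerm_layer_le_axis (z := z) (m := 2 ^ J) h3
      push_cast at hle
      rw [← hg J] at hle
      exact hle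
    have hcard : (#((box 2 (2 ^ (J + 1 + 2))).erase 0 \ (box 2 (2 ^ (J + 2))).erase 0) : ℝ) ≤
        2 ^ 10 * 4 ^ J := by
      have h1 : #((box 2 (2 ^ (J + 1 + 2))).erase 0 \ (box 2 (2 ^ (J + 2))).erase 0) ≤
          #(box 2 (2 ^ (J + 1 + 2))) :=
        Finset.card_le_card (Finset.sdiff_subset.trans (Finset.erase_subset _ _))
      rw [card_box] at h1
      have h2 : (2 * 2 ^ (J + 1 + 2) + 1) ^ 2 ≤ 2 ^ 10 * 4 ^ J := by
        have : 2 * 2 ^ (J + 1 + 2) + 1 ≤ 2 ^ (J + 5) := by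
          have : 2 ^ (J + 5) = 2 * 2 ^ (J + 1 + 2) + 2 * 2 ^ (J + 1 + 2) := by ring
          have : 1 ≤ 2 ^ (J + 1 + 2) := Nat.one_le_two_pow
          omega
        calc (2 * 2 ^ (J + 1 + 2) + 1) ^ 2 ≤ (2 ^ (J + 5)) ^ 2 := Nat.pow_le_pow_left this 2
          _ = 2 ^ 10 * 4 ^ J := by
            rw [← pow_mul, show (4:ℕ) = 2 ^ 2 by norm_num, ← pow_mul, ← pow_add]; ring_nf
      exact_mod_cast h1.trans h2
    calc ∑ z ∈ (box 2 (2 ^ (J + 1 + 2))).erase 0 \ (box 2 (2 ^ (J + 2))).erase 0,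
          criticalTwoPoint 3 (Fin.cons 0 z)
        ≤ ∑ _z ∈ (box 2 (2 ^ (J + 1 + 2))).erase 0 \ (box 2 (2 ^ (J + 2))).erase 0, g J :=
          Finset.sum_le_sum hterm
      _ = (#((box 2 (2 ^ (J + 1 + 2))).erase 0 \ (box 2 (2 ^ (J + 2))).erase 0) : ℝ) * g J := by
          rw [Finset.sum_const, nsmul_eq_mul]
      _ ≤ 2 ^ 10 * 4 ^ J * g J := mul_le_mul_of_nonneg_right hcard (hgpos J).le
  -- the constant
  set K : ℝ := max (Φ i₀ / (4 ^ i₀ * g i₀)) (2 ^ 10 * θ / (4 - θ)) with hKdef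
  have hK2 : 2 ^ 10 * θ / (4 - θ) ≤ K := le_max_right _ _
  have hK1 : Φ i₀ / (4 ^ i₀ * g i₀) ≤ K := le_max_left _ _
  have hKpos : 0 < K := lt_of_lt_of_le (div_pos (mul_pos (by norm_num) hθ) (by linarith)) hK2
  have hmain : ∀ J, i₀ ≤ J → Φ J ≤ K * 4 ^ J * g J := by
    intro J hJ
    induction J, hJ using Nat.le_induction with
    | base =>
      have hden : 0 < (4:ℝ) ^ i₀ * g i₀ := mul_pos (by positivity) (hgpos i₀)
      have := (div_le_iff₀ hden).1 hK1
      simpa only [mul_assoc] using this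
    | succ J hJ ih =>
      have hθJ := hgθ J hJ
      have hKθ : (K + 2 ^ 10) * θ ≤ 4 * K := by
        have h8 : 0 < 4 - θ := by linarith
        have := (div_le_iff₀ h8).1 hK2
        nlinarith
      have h4J : (0:ℝ) < 4 ^ J := by positivity
      have hK10 : (0:ℝ) ≤ K + 2 ^ 10 := add_nonneg hKpos.le (by positivity)
      calc Φ (J + 1) ≤ Φ J + 2 ^ 10 * 4 ^ J * g J := hstep J
        _ ≤ K * 4 ^ J * g J + 2 ^ 10 * 4 ^ J * g J := by linarith [ih]
        _ = (K + 2 ^ 10) * 4 ^ J * g J := by ring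
        _ ≤ (K + 2 ^ 10) * 4 ^ J * (θ * g (J + 1)) :=
            mul_le_mul_of_nonneg_left hθJ (mul_nonneg hK10 h4J.le)
        _ = ((K + 2 ^ 10) * θ) * 4 ^ J * g (J + 1) := by ring
        _ ≤ (4 * K) * 4 ^ J * g (J + 1) :=
            mul_le_mul_of_nonneg_right (mul_le_mul_of_nonneg_right hKθ h4J.le) (hgpos (J + 1)).le
        _ = K * 4 ^ (J + 1) * g (J + 1) := by rw [pow_succ]; ring
  refine ⟨K, θ, hKpos, hθ, hθM, i₀, hi₀, fun J hJ => ?_⟩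
  have h := hmain J hJ
  rwa [hΦ J, hg J] at h

/-- **`n² ⟨σ₀σ_{2n e₀}⟩_{β_c} → ∞`**: with `2^J ≤ n < 2^{J+1}`, axis monotonicity and the dyadic
chain give `⟨σ₀σ_{2n e₀}⟩ ≥ ⟨σ₀σ_{2^{J+2} e₀}⟩ ≥ θ^{-(J+2-i₀)} ⟨σ₀σ_{2^{i₀} e₀}⟩`, and `(4/θ)^J → ∞`.
[folklore] -/
theorem doubleTerm_tendsto_sq_mul_axis {θ : ℝ} (hθ : 0 < θ) (hθM : θ < 4) {i₀ : ℕ}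
    (h : ∀ i, i₀ ≤ i → criticalTwoPoint 3 (Pi.single (0 : Fin 3) ((2:ℤ) ^ i)) ≤
      θ * criticalTwoPoint 3 (Pi.single (0 : Fin 3) ((2:ℤ) ^ (i + 1)))) :
    Tendsto (fun n : ℕ => (n:ℝ) ^ 2 * criticalTwoPoint 3 (Pi.single (0 : Fin 3) ((2 * n : ℕ) : ℤ)))
      atTop atTop := by
  set c := criticalTwoPoint 3 (Pi.single (0 : Fin 3) ((2:ℤ) ^ i₀)) with hc
  have hcpos : 0 < c := Summit.CriticalPhenomena.Ising3DConformalLimit.PinnedClusterPoints.criticalTwoPoint_pos3 _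
  have hlog : Tendsto (Nat.log 2) atTop atTop :=
    Filter.tendsto_atTop_atTop.2 fun b => ⟨2 ^ b, fun m hm => Nat.le_log_of_pow_le one_lt_two hm⟩
  have hr : 1 < 4 / θ := (one_lt_div hθ).2 hθM
  have hC : 0 < c * θ ^ i₀ / θ ^ 2 := by positivity
  have hmodel : Tendsto (fun n : ℕ => c * θ ^ i₀ / θ ^ 2 * (4 / θ) ^ Nat.log 2 n) atTop atTop :=
    ((tendsto_pow_atTop_atTop_of_one_lt hr).comp hlog).const_mul_atTop hC
  refine tendsto_atTop_mono' atTop ?_ hmodel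
  filter_upwards [eventually_ge_atTop (2 ^ i₀)] with n hn
  set J := Nat.log 2 n with hJdef
  have hn0 : n ≠ 0 := by have := Nat.one_le_two_pow (n := i₀); omega
  have hlo : 2 ^ J ≤ n := Nat.pow_log_le_self 2 hn0
  have hhi : n < 2 ^ (J + 1) := Nat.lt_pow_succ_log_self one_lt_two n
  have hchain := doubleTerm_dyadic_chain hθ h i₀ (J + 2 - i₀) le_rfl
  have hJi : i₀ ≤ J := Nat.le_log_of_pow_le one_lt_two hn
  rw [show i₀ + (J + 2 - i₀) = J + 2 by omega, ← hc] at hchain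
  have hanti : criticalTwoPoint 3 (Pi.single (0 : Fin 3) ((2:ℤ) ^ (J + 2))) ≤
      criticalTwoPoint 3 (Pi.single (0 : Fin 3) ((2 * n : ℕ) : ℤ)) := by
    have e : 2 ^ (J + 2) = 2 ^ (J + 1) * 2 := by rw [← pow_succ]
    have := criticalTwoPoint_axis_antitone (show 2 * n ≤ 2 ^ (J + 2) by omega)
    push_cast at this
    exact this
  have hθa : θ ^ (J + 2 - i₀) = θ ^ J * θ ^ 2 / θ ^ i₀ := by
    rw [eq_div_iff (pow_ne_zero _ hθ.ne'), ← pow_add, ← pow_add]; congr 1; omega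
  have h4J : (4:ℝ) ^ J ≤ (n:ℝ) ^ 2 := by
    have h2 : ((2:ℝ) ^ J) ≤ n := by exact_mod_cast hlo
    calc (4:ℝ) ^ J = ((2:ℝ) ^ J) ^ 2 := by
          rw [← pow_mul, show (4:ℝ) = 2 ^ 2 by norm_num, ← pow_mul, mul_comm]
      _ ≤ (n:ℝ) ^ 2 := pow_le_pow_left₀ (by positivity) h2 2
  have hG : 0 ≤ criticalTwoPoint 3 (Pi.single (0 : Fin 3) ((2:ℤ) ^ (J + 2))) :=
    criticalTwoPoint_nonneg' _
  calc c * θ ^ i₀ / θ ^ 2 * (4 / θ) ^ J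
      ≤ (θ ^ (J + 2 - i₀) * criticalTwoPoint 3 (Pi.single (0 : Fin 3) ((2:ℤ) ^ (J + 2)))) *
          θ ^ i₀ / θ ^ 2 * (4 / θ) ^ J := by gcongr
    _ = criticalTwoPoint 3 (Pi.single (0 : Fin 3) ((2:ℤ) ^ (J + 2))) * 4 ^ J := by
        rw [hθa, div_pow]
        field_simp
    _ ≤ criticalTwoPoint 3 (Pi.single (0 : Fin 3) ((2 * n : ℕ) : ℤ)) * (n:ℝ) ^ 2 :=
        mul_le_mul hanti h4J (by positivity) (criticalTwoPoint_nonneg' _)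
    _ = (n:ℝ) ^ 2 * criticalTwoPoint 3 (Pi.single (0 : Fin 3) ((2 * n : ℕ) : ℤ)) := mul_comm _ _

/-- **Registered bookkeeping sub-goal `stub_doubleTermLimit_nearDiagonal` of stub B2
`stub_doubleTermLimit` (helper 1/3): the lattice input for the near-diagonal block.** For a
pointwise scaling limit of the critical Ising₃ correlators with non-degenerate two-point function and
scale covariance of dimension `Δ < 1`: `n² ⟨σ₀σ_{2n e₀}⟩ → ∞`, and there are `C > 0`, `θ ∈ (0,4)` such
that for every `p`, all large `n` admit a sup-norm threshold `M` with `2n < 2^p M ≤ 4n` and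
`Σ_{z ∈ ℤ², 0 < ‖z‖_∞ ≤ M} ⟨σ₀σ_{(0,z)}⟩_{β_c} ≤ C (θ/4)^p n² ⟨σ₀σ_{2n e₀}⟩_{β_c}` (layer shell sums at the
dyadic scale `2^{J+2} = 2^p M`-comparable to `n`, the dyadic chain `θ^{p+2}` up to scale `4n`, and axis
monotonicity). [cite: BinghamGoldieTeugels1987, §1.5.6, Karamata's theorem (direct half)] -/
theorem stub_doubleTermLimit_nearDiagonal :
    ∀ (ρ : ℝ → ℝ) (Δ : ℝ) (S : CorrFamily 3), HasPointwiseScalingLimit (criticalCorr 3) ρ S →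
      IsNondegenerateTwoPoint S → IsScaleCovariant Δ S → Δ < 1 →
      Tendsto (fun n : ℕ => (n:ℝ) ^ 2 * criticalTwoPoint 3 (Pi.single (0 : Fin 3) ((2 * n : ℕ) : ℤ)))
          atTop atTop ∧
      ∃ C θ : ℝ, 0 < C ∧ 0 < θ ∧ θ < 4 ∧ ∀ p : ℕ, ∃ N₀ : ℕ, ∀ n : ℕ, N₀ ≤ n → ∃ M : ℕ,
        2 * n < M * 2 ^ p ∧ M * 2 ^ p ≤ 4 * n ∧
        ∑ z ∈ (box 2 M).erase 0, criticalTwoPoint 3 (Fin.cons 0 z) ≤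
          C * (θ / 4) ^ p * (n:ℝ) ^ 2 * criticalTwoPoint 3 (Pi.single (0 : Fin 3) ((2 * n : ℕ) : ℤ)) := by
  intro ρ Δ S hlim hnd hsc hΔ1
  obtain ⟨K, θ, hK, hθ, hθM, i₀, hstep, hshell⟩ := doubleTerm_layer_shell_sum hlim hnd hsc hΔ1
  refine ⟨doubleTerm_tendsto_sq_mul_axis hθ hθM hstep, K * θ ^ 2, θ, by positivity, hθ, hθM,
    fun p => ⟨2 ^ (p + i₀ + 1), fun n hn => ?_⟩⟩
  set Jn := Nat.log 2 n with hJn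
  have hn0 : n ≠ 0 := by have := Nat.one_le_two_pow (n := p + i₀ + 1); omega
  have hJge : p + i₀ + 1 ≤ Jn := Nat.le_log_of_pow_le one_lt_two hn
  have hlo : 2 ^ Jn ≤ n := Nat.pow_log_le_self 2 hn0
  have hhi : n < 2 ^ (Jn + 1) := Nat.lt_pow_succ_log_self one_lt_two n
  set J := Jn - p with hJ
  have hJi : i₀ ≤ J := by omega
  have e1 : 2 ^ (J + 2) * 2 ^ p = 2 ^ (Jn + 1) * 2 := by
    rw [← pow_add, ← pow_succ]; congr 1; omega
  have e2 : 2 ^ (J + 2) * 2 ^ p = 2 ^ Jn * 4 := by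
    rw [← pow_add, show J + 2 + p = Jn + 2 by omega, pow_add]; norm_num
  refine ⟨2 ^ (J + 2), by rw [e1]; omega, by rw [e2]; omega, ?_⟩
  have h1 := hshell J hJi
  have h2 := doubleTerm_dyadic_chain hθ hstep J (p + 2) hJi
  have hanti : criticalTwoPoint 3 (Pi.single (0 : Fin 3) ((2:ℤ) ^ (J + (p + 2)))) ≤
      criticalTwoPoint 3 (Pi.single (0 : Fin 3) ((2 * n : ℕ) : ℤ)) := by
    have e3 : 2 ^ (J + (p + 2)) = 2 ^ (Jn + 1) * 2 := by rw [← pow_succ]; congr 1; omega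
    have := criticalTwoPoint_axis_antitone (show 2 * n ≤ 2 ^ (J + (p + 2)) by omega)
    push_cast at this
    exact this
  have h4 : (4:ℝ) ^ J * 4 ^ p ≤ (n:ℝ) ^ 2 := by
    have h2n : ((2:ℝ) ^ Jn) ≤ n := by exact_mod_cast hlo
    calc (4:ℝ) ^ J * 4 ^ p = ((2:ℝ) ^ Jn) ^ 2 := by
          rw [← pow_add, show J + p = Jn by omega, ← pow_mul, show (4:ℝ) = 2 ^ 2 by norm_num,
            ← pow_mul, mul_comm]
      _ ≤ (n:ℝ) ^ 2 := pow_le_pow_left₀ (by positivity) h2n 2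
  have hgn : 0 ≤ criticalTwoPoint 3 (Pi.single (0 : Fin 3) ((2 * n : ℕ) : ℤ)) :=
    criticalTwoPoint_nonneg' _
  calc ∑ z ∈ (box 2 (2 ^ (J + 2))).erase 0, criticalTwoPoint 3 (Fin.cons 0 z)
      ≤ K * 4 ^ J * criticalTwoPoint 3 (Pi.single (0 : Fin 3) ((2:ℤ) ^ J)) := h1
    _ ≤ K * 4 ^ J * (θ ^ (p + 2) *
          criticalTwoPoint 3 (Pi.single (0 : Fin 3) ((2:ℤ) ^ (J + (p + 2))))) := by gcongr
    _ ≤ K * 4 ^ J * (θ ^ (p + 2) * criticalTwoPoint 3 (Pi.single (0 : Fin 3) ((2 * n : ℕ) : ℤ))) := by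
        gcongr
    _ = K * θ ^ 2 * (θ / 4) ^ p * ((4:ℝ) ^ J * 4 ^ p) *
          criticalTwoPoint 3 (Pi.single (0 : Fin 3) ((2 * n : ℕ) : ℤ)) := by
        rw [div_pow]; field_simp; ring
    _ ≤ K * θ ^ 2 * (θ / 4) ^ p * (n:ℝ) ^ 2 *
          criticalTwoPoint 3 (Pi.single (0 : Fin 3) ((2 * n : ℕ) : ℤ)) := by gcongr

end Summit.CriticalPhenomena.Ising3DConformalLimit.Cruxes.GaussianLimitNotScreened.SingleLayerLinearRegression

end
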